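import Mathlib
import Summits.Ventures.PercRepro2.CoinD31PrsCellsA
import Summits.Ventures.PercRepro2.CoinD31PrsCellsB
import Summits.Ventures.PercRepro2.CoinD31PrsCellsC
import Summits.Ventures.PercRepro2.CoinD31PrsCellsD
import Summits.Ventures.PercRepro2.CoinD31PrsCellsE
import Summits.Ventures.PercRepro2.CoinD31PrsCellsF
import Summits.Ventures.PercRepro2.CoinD31PrsCellsG
import Summits.Ventures.PercRepro2.CoinD31PrsCellsH
import Summits.Ventures.PercRepro2.CoinD31PrsCellsI
import Summits.Ventures.PercRepro2.CoinD31PrsCellsJ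
import Summits.Ventures.PercRepro2.CoinD31PrsCellsK
import Summits.Ventures.PercRepro2.CoinD31PrsCellsL
import Summits.Ventures.PercRepro2.CoinD31PrsCellsM
import Summits.Ventures.PercRepro2.CoinD31PrsCellsN
import Summits.Ventures.PercRepro2.CoinD31PrsCellsO
import Summits.Ventures.PercRepro2.CoinD31PrsAlg
import Summits.Ventures.PercRepro2.CoinOrTailAlg
import Summits.Ventures.PercRepro2.CoinOrTail3Cells
import Summits.Ventures.PercRepro2.CoinOrTail4Cells

/-!
# The OR-tail with BOTH MARKERS FAR ON ONE ROUTE over log-supermodular branches: the abstract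
functional (blind cell PercRepro2, night-2 g9; proofs/NIGHT2-DARC.md §38)

`orTailFar2_functional_nonneg`: the tail is entered from `u` (probability `δ`) and from `q`
(probability `ε`); the weight `ν` vanishes off the chain `u ∈ W → r ∈ W → p ∈ W` (`p, r` cut
vertices above the attachment point `u`); the MARKERS are `p` and `r`.  The nineteen four-marker
cell sums are the head values of the (3,1) core `s → p → r → u → a ← q ← s` with the markers `p, r`
(`D31Prs_cert`, the staged 9,524-term certificate); the class weights are absorbed by
`α = 1, α' = 1/3, β = 1, β' = 1/2, γ = γ' = ζ = ζ' = 1`; its nine lsm steps hold for the cell sums by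
Ahlswede–Daykin (`cellSum4_mul_le`), its six monotone steps termwise.
-/

namespace Summit.Ventures.PercRepro2.Coin

section OrTailFar2Alg

variable {V : Type*} [DecidableEq V] {R : Type*} [Field R] [LinearOrder R] [IsStrictOrderedRing R]

set_option maxHeartbeats 0 in
/-- **THE TWO-FAR-MARKERS-ON-ONE-ROUTE OR-TAIL FUNCTIONAL IS NONNEGATIVE** (cell-averaging +
Ahlswede–Daykin + `D31Prs_cert`). -/
theorem orTailFar2_functional_nonneg (U : Finset V) (ν A : Finset V → R) (p r u q a w : V) (δ ε : R)
    (haU : a ∉ U) (hwU : w ∉ U)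
    (hδ0 : 0 ≤ δ) (hδ1 : δ ≤ 1) (hε0 : 0 ≤ ε) (hε1 : ε ≤ 1)
    (hν0 : ∀ W, 0 ≤ ν W) (hν : ∀ s ⊆ U, ∀ t ⊆ U, ν s * ν t ≤ ν (s ∩ t) * ν (s ∪ t))
    (hbad : ∀ W ⊆ U, ¬ ((u ∈ W → r ∈ W) ∧ (r ∈ W → p ∈ W)) → ν W = 0)
    (hA0 : ∀ W, 0 ≤ A W) (hA : ∀ s t : Finset V, A s * A t ≤ A (s ∩ t) * A (s ∪ t))
    (hAmono : ∀ s t : Finset V, s ⊆ t → A t ≤ A s) :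
    0 ≤ (∑ W ∈ U.powerset, ν W * rVal A u q a δ ε W) ^ 2 *
          (∑ W ∈ U.powerset, ν W * gVal A u q a w δ ε W *
            ((if p ∈ W then (1 : R) else 0) * (if r ∈ W then (1 : R) else 0)))
        - (∑ W ∈ U.powerset, ν W * rVal A u q a δ ε W) *
          (∑ W ∈ U.powerset, ν W * rVal A u q a δ ε W * (if p ∈ W then (1 : R) else 0)) *
          (∑ W ∈ U.powerset, ν W * gVal A u q a w δ ε W * (if r ∈ W then (1 : R) else 0))
        - (∑ W ∈ U.powerset, ν W * rVal A u q a δ ε W) *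
          (∑ W ∈ U.powerset, ν W * rVal A u q a δ ε W * (if r ∈ W then (1 : R) else 0)) *
          (∑ W ∈ U.powerset, ν W * gVal A u q a w δ ε W * (if p ∈ W then (1 : R) else 0))
        + (∑ W ∈ U.powerset, ν W * rVal A u q a δ ε W * (if p ∈ W then (1 : R) else 0)) *
          (∑ W ∈ U.powerset, ν W * rVal A u q a δ ε W * (if r ∈ W then (1 : R) else 0)) *
          (∑ W ∈ U.powerset, ν W * gVal A u q a w δ ε W) := by
  set A_e := cellSum4 U ν A p r u q false false false false ∅ with hA_e
  set A_p := cellSum4 U ν A p r u q true false false false ∅ with hA_p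
  set A_q := cellSum4 U ν A p r u q false false false true ∅ with hA_q
  set A_ap := cellSum4 U ν A p r u q true false false false {a} with hA_ap
  set A_aq := cellSum4 U ν A p r u q false false false true {a} with hA_aq
  set A_pq := cellSum4 U ν A p r u q true false false true ∅ with hA_pq
  set A_pr := cellSum4 U ν A p r u q true true false false ∅ with hA_pr
  set A_apq := cellSum4 U ν A p r u q true false false true {a} with hA_apq
  set A_aqw := cellSum4 U ν A p r u q false false false true {a, w} with hA_aqw
  set A_pqr := cellSum4 U ν A p r u q true true false true ∅ with hA_pqr
  set A_pru := cellSum4 U ν A p r u q true true true false ∅ with hA_pru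
  set A_apqr := cellSum4 U ν A p r u q true true false true {a} with hA_apqr
  set A_apqw := cellSum4 U ν A p r u q true false false true {a, w} with hA_apqw
  set A_apru := cellSum4 U ν A p r u q true true true false {a} with hA_apru
  set A_pqru := cellSum4 U ν A p r u q true true true true ∅ with hA_pqru
  set A_apqru := cellSum4 U ν A p r u q true true true true {a} with hA_apqru
  set A_apqrw := cellSum4 U ν A p r u q true true false true {a, w} with hA_apqrw
  set A_apruw := cellSum4 U ν A p r u q true true true false {a, w} with hA_apruw
  set A_apqruw := cellSum4 U ν A p r u q true true true true {a, w} with hA_apqruw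
  have hXa : Disjoint ({a} : Finset V) U := Finset.disjoint_singleton_left.2 haU
  have hXaw : Disjoint ({a, w} : Finset V) U := by
    rw [Finset.disjoint_left]
    intro x hx
    simp only [Finset.mem_insert, Finset.mem_singleton] at hx
    rcases hx with rfl | rfl
    · exact haU
    · exact hwU
  have hX0 : Disjoint (∅ : Finset V) U := Finset.disjoint_empty_left U
  have L := cellSum4_mul_le U ν A p r u q hν0 hν hA0 hA
  have hl1 : A_apqr * A_apqw ≤ A_apq * A_apqrw := by
    have := L true true false true true false false true {a} {a, w} hXa hXaw
    simpa only [Bool.and_self, Bool.and_false, Bool.false_and, Bool.and_true, Bool.true_and, Bool.or_self, Bool.true_or, Bool.or_true, Bool.false_or, Bool.or_false, Finset.inter_self, Finset.union_self, Finset.empty_inter, Finset.inter_empty, Finset.empty_union, Finset.union_empty, Finset.inter_comm ({a, w} : Finset V) {a}, Finset.union_comm ({a, w} : Finset V) {a}, singleton_inter_pair, singleton_union_pair] using this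
  have hl2 : A_apqw * A_apqru ≤ A_apq * A_apqruw := by
    have := L true false false true true true true true {a, w} {a} hXaw hXa
    simpa only [Bool.and_self, Bool.and_false, Bool.false_and, Bool.and_true, Bool.true_and, Bool.or_self, Bool.true_or, Bool.or_true, Bool.false_or, Bool.or_false, Finset.inter_self, Finset.union_self, Finset.empty_inter, Finset.inter_empty, Finset.empty_union, Finset.union_empty, Finset.inter_comm ({a, w} : Finset V) {a}, Finset.union_comm ({a, w} : Finset V) {a}, singleton_inter_pair, singleton_union_pair] using this
  have hl3 : A_apqw * A_apru ≤ A_ap * A_apqruw := by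
    have := L true false false true true true true false {a, w} {a} hXaw hXa
    simpa only [Bool.and_self, Bool.and_false, Bool.false_and, Bool.and_true, Bool.true_and, Bool.or_self, Bool.true_or, Bool.or_true, Bool.false_or, Bool.or_false, Finset.inter_self, Finset.union_self, Finset.empty_inter, Finset.inter_empty, Finset.empty_union, Finset.union_empty, Finset.inter_comm ({a, w} : Finset V) {a}, Finset.union_comm ({a, w} : Finset V) {a}, singleton_inter_pair, singleton_union_pair] using this
  have hl4 : A_apqw * A_pqru ≤ A_pq * A_apqruw := by
    have := L true false false true true true true true {a, w} ∅ hXaw hX0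
    simpa only [Bool.and_self, Bool.and_false, Bool.false_and, Bool.and_true, Bool.true_and, Bool.or_self, Bool.true_or, Bool.or_true, Bool.false_or, Bool.or_false, Finset.inter_self, Finset.union_self, Finset.empty_inter, Finset.inter_empty, Finset.empty_union, Finset.union_empty, Finset.inter_comm ({a, w} : Finset V) {a}, Finset.union_comm ({a, w} : Finset V) {a}, singleton_inter_pair, singleton_union_pair] using this
  have hl5 : A_aq * A_pq ≤ A_q * A_apq := by
    have := L false false false true true false false true {a} ∅ hXa hX0
    simpa only [Bool.and_self, Bool.and_false, Bool.false_and, Bool.and_true, Bool.true_and, Bool.or_self, Bool.true_or, Bool.or_true, Bool.false_or, Bool.or_false, Finset.inter_self, Finset.union_self, Finset.empty_inter, Finset.inter_empty, Finset.empty_union, Finset.union_empty, Finset.inter_comm ({a, w} : Finset V) {a}, Finset.union_comm ({a, w} : Finset V) {a}, singleton_inter_pair, singleton_union_pair] using this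
  have hl6 : A_p * A_aq ≤ A_e * A_apq := by
    have := L true false false false false false false true ∅ {a} hX0 hXa
    simpa only [Bool.and_self, Bool.and_false, Bool.false_and, Bool.and_true, Bool.true_and, Bool.or_self, Bool.true_or, Bool.or_true, Bool.false_or, Bool.or_false, Finset.inter_self, Finset.union_self, Finset.empty_inter, Finset.inter_empty, Finset.empty_union, Finset.union_empty, Finset.inter_comm ({a, w} : Finset V) {a}, Finset.union_comm ({a, w} : Finset V) {a}, singleton_inter_pair, singleton_union_pair] using this
  have hl7 : A_pqr * A_apqw ≤ A_pq * A_apqrw := by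
    have := L true true false true true false false true ∅ {a, w} hX0 hXaw
    simpa only [Bool.and_self, Bool.and_false, Bool.false_and, Bool.and_true, Bool.true_and, Bool.or_self, Bool.true_or, Bool.or_true, Bool.false_or, Bool.or_false, Finset.inter_self, Finset.union_self, Finset.empty_inter, Finset.inter_empty, Finset.empty_union, Finset.union_empty, Finset.inter_comm ({a, w} : Finset V) {a}, Finset.union_comm ({a, w} : Finset V) {a}, singleton_inter_pair, singleton_union_pair] using this
  have hl8 : A_pr * A_apqw ≤ A_p * A_apqrw := by
    have := L true true false false true false false true ∅ {a, w} hX0 hXaw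
    simpa only [Bool.and_self, Bool.and_false, Bool.false_and, Bool.and_true, Bool.true_and, Bool.or_self, Bool.true_or, Bool.or_true, Bool.false_or, Bool.or_false, Finset.inter_self, Finset.union_self, Finset.empty_inter, Finset.inter_empty, Finset.empty_union, Finset.union_empty, Finset.inter_comm ({a, w} : Finset V) {a}, Finset.union_comm ({a, w} : Finset V) {a}, singleton_inter_pair, singleton_union_pair] using this
  have hl9 : A_pru * A_apqw ≤ A_p * A_apqruw := by
    have := L true true true false true false false true ∅ {a, w} hX0 hXaw
    simpa only [Bool.and_self, Bool.and_false, Bool.false_and, Bool.and_true, Bool.true_and, Bool.or_self, Bool.true_or, Bool.or_true, Bool.false_or, Bool.or_false, Finset.inter_self, Finset.union_self, Finset.empty_inter, Finset.inter_empty, Finset.empty_union, Finset.union_empty, Finset.inter_comm ({a, w} : Finset V) {a}, Finset.union_comm ({a, w} : Finset V) {a}, singleton_inter_pair, singleton_union_pair] using this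
  have M := cellSum4_mono U ν A p r u q hν0 hAmono
  have ha_aw : ({a} : Finset V) ⊆ {a, w} := by simp
  have h0_a : (∅ : Finset V) ⊆ {a} := Finset.empty_subset _
  have h0_aw : (∅ : Finset V) ⊆ {a, w} := Finset.empty_subset _
  have hm1 : A_apqw ≤ A_apq := M true false false true {a} {a, w} ha_aw
  have hm2 : A_ap ≤ A_p := M true false false false ∅ {a} h0_a
  have hm3 : A_apqw ≤ A_pq := M true false false true ∅ {a, w} h0_aw
  have hm4 : A_apru ≤ A_pru := M true true true false ∅ {a} h0_a
  have hm5 : A_aq ≤ A_q := M false false false true ∅ {a} h0_a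
  have N := cellSum4_nonneg U ν A p r u q hν0 hA0
  have key := D31Prs_cert (1 : R) (1 / 3) 1 (1 / 2) 1 1 1 1 δ (1 - δ) ε (1 - ε) A_e A_p A_q A_ap A_aq A_pq A_pr A_apq A_aqw A_pqr A_pru A_apqr A_apqw A_apru A_pqru A_apqru A_apqrw A_apruw A_apqruw
    zero_le_one (by norm_num) zero_le_one (by norm_num) zero_le_one zero_le_one zero_le_one zero_le_one
    hδ0 (sub_nonneg.2 hδ1) hε0 (sub_nonneg.2 hε1) (N _ _ _ _ _) (N _ _ _ _ _) (N _ _ _ _ _) (N _ _ _ _ _) (N _ _ _ _ _) (N _ _ _ _ _) (N _ _ _ _ _) (N _ _ _ _ _) (N _ _ _ _ _) (N _ _ _ _ _) (N _ _ _ _ _) (N _ _ _ _ _) (N _ _ _ _ _) (N _ _ _ _ _) (N _ _ _ _ _) (N _ _ _ _ _) (N _ _ _ _ _) (N _ _ _ _ _)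
    hl1 hl2 hl3 hl4 hl5 hl6 hl7 hl8 hl9 hm1 hm2 hm3 hm4 hm5
  have hpt : ∀ W ∈ U.powerset,
      ν W * goodWt2 p r u W * rVal A u q a δ ε W =
        (ν W * cellWt4 p r u q false false false false W * A (W ∪ ∅))
        + (ν W * cellWt4 p r u q true false false false W * A (W ∪ ∅))
        + (1 - ε) * (ν W * cellWt4 p r u q false false false true W * A (W ∪ ∅))
        + ε * (ν W * cellWt4 p r u q false false false true W * A (W ∪ {a}))
        + (1 - ε) * (ν W * cellWt4 p r u q true false false true W * A (W ∪ ∅))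
        + ε * (ν W * cellWt4 p r u q true false false true W * A (W ∪ {a}))
        + (ν W * cellWt4 p r u q true true false false W * A (W ∪ ∅))
        + (1 - ε) * (ν W * cellWt4 p r u q true true false true W * A (W ∪ ∅))
        + ε * (ν W * cellWt4 p r u q true true false true W * A (W ∪ {a}))
        + (1 - δ) * (ν W * cellWt4 p r u q true true true false W * A (W ∪ ∅))
        + δ * (ν W * cellWt4 p r u q true true true false W * A (W ∪ {a}))
        + (1 - δ) * (1 - ε) * (ν W * cellWt4 p r u q true true true true W * A (W ∪ ∅))
        + (δ * ε + δ * (1 - ε) + (1 - δ) * ε) * (ν W * cellWt4 p r u q true true true true W * A (W ∪ {a})) := by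
    intro W _
    simp only [rVal, tailWt, cellWt4, mWt, goodWt2, Finset.union_empty]
    by_cases hp : p ∈ W <;> by_cases hr : r ∈ W <;> by_cases hu : u ∈ W <;> by_cases hq : q ∈ W <;>
      simp [hp, hr, hu, hq] <;> ring
  have hpg : ∀ W ∈ U.powerset,
      ν W * goodWt2 p r u W * gVal A u q a w δ ε W =
        (ν W * cellWt4 p r u q false false false false W * A (W ∪ ∅))
        + (ν W * cellWt4 p r u q true false false false W * A (W ∪ ∅))
        + (1 - ε) * (ν W * cellWt4 p r u q false false false true W * A (W ∪ ∅))
        + ε * (ν W * cellWt4 p r u q false false false true W * A (W ∪ {a, w}))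
        + (1 - ε) * (ν W * cellWt4 p r u q true false false true W * A (W ∪ ∅))
        + ε * (ν W * cellWt4 p r u q true false false true W * A (W ∪ {a, w}))
        + (ν W * cellWt4 p r u q true true false false W * A (W ∪ ∅))
        + (1 - ε) * (ν W * cellWt4 p r u q true true false true W * A (W ∪ ∅))
        + ε * (ν W * cellWt4 p r u q true true false true W * A (W ∪ {a, w}))
        + (1 - δ) * (ν W * cellWt4 p r u q true true true false W * A (W ∪ ∅))
        + δ * (ν W * cellWt4 p r u q true true true false W * A (W ∪ {a, w}))
        + (1 - δ) * (1 - ε) * (ν W * cellWt4 p r u q true true true true W * A (W ∪ ∅))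
        + (δ * ε + δ * (1 - ε) + (1 - δ) * ε) * (ν W * cellWt4 p r u q true true true true W * A (W ∪ {a, w})) := by
    intro W _
    simp only [gVal, tailWt, cellWt4, mWt, goodWt2, Finset.union_empty]
    by_cases hp : p ∈ W <;> by_cases hr : r ∈ W <;> by_cases hu : u ∈ W <;> by_cases hq : q ∈ W <;>
      simp [hp, hr, hu, hq] <;> ring
  have hΛ : ∑ W ∈ U.powerset, ν W * rVal A u q a δ ε W =
      A_e + A_p + (1 - ε) * A_q + ε * A_aq + (1 - ε) * A_pq + ε * A_apq + A_pr + (1 - ε) * A_pqr + ε * A_apqr + (1 - δ) * A_pru + δ * A_apru + (1 - δ) * (1 - ε) * A_pqru + (δ * ε + δ * (1 - ε) + (1 - δ) * ε) * A_apqru := by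
    rw [sum_eq_sum_goodWt2 U ν p r u hbad]
    simp only [hA_e, hA_p, hA_q, hA_aq, hA_pq, hA_pr, hA_apq, hA_pqr, hA_pru, hA_apqr, hA_apru, hA_pqru, hA_apqru, cellSum4, Finset.mul_sum, ← Finset.sum_add_distrib]
    exact Finset.sum_congr rfl hpt
  have hFa : ∑ W ∈ U.powerset, ν W * rVal A u q a δ ε W * (if p ∈ W then (1 : R) else 0) =
      A_p + (1 - ε) * A_pq + ε * A_apq + A_pr + (1 - ε) * A_pqr + ε * A_apqr + (1 - δ) * A_pru + δ * A_apru + (1 - δ) * (1 - ε) * A_pqru + (δ * ε + δ * (1 - ε) + (1 - δ) * ε) * A_apqru := by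
    rw [sum_eq_sum_goodWt2' U ν p r u hbad]
    simp only [hA_p, hA_pq, hA_pr, hA_apq, hA_pqr, hA_pru, hA_apqr, hA_apru, hA_pqru, hA_apqru, cellSum4, Finset.mul_sum, ← Finset.sum_add_distrib]
    refine Finset.sum_congr rfl fun W hW => ?_
    rw [hpt W hW]
    simp only [cellWt4, mWt, Finset.union_empty]
    by_cases hp : p ∈ W <;> by_cases hr : r ∈ W <;> by_cases hu : u ∈ W <;> by_cases hq : q ∈ W <;> simp [hp, hr, hu, hq]
  have hFb : ∑ W ∈ U.powerset, ν W * rVal A u q a δ ε W * (if r ∈ W then (1 : R) else 0) =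
      A_pr + (1 - ε) * A_pqr + ε * A_apqr + (1 - δ) * A_pru + δ * A_apru + (1 - δ) * (1 - ε) * A_pqru + (δ * ε + δ * (1 - ε) + (1 - δ) * ε) * A_apqru := by
    rw [sum_eq_sum_goodWt2' U ν p r u hbad]
    simp only [hA_pr, hA_pqr, hA_pru, hA_apqr, hA_apru, hA_pqru, hA_apqru, cellSum4, Finset.mul_sum, ← Finset.sum_add_distrib]
    refine Finset.sum_congr rfl fun W hW => ?_
    rw [hpt W hW]
    simp only [cellWt4, mWt, Finset.union_empty]
    by_cases hp : p ∈ W <;> by_cases hr : r ∈ W <;> by_cases hu : u ∈ W <;> by_cases hq : q ∈ W <;> simp [hp, hr, hu, hq]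
  have hM : ∑ W ∈ U.powerset, ν W * gVal A u q a w δ ε W =
      A_e + A_p + (1 - ε) * A_q + ε * A_aqw + (1 - ε) * A_pq + ε * A_apqw + A_pr + (1 - ε) * A_pqr + ε * A_apqrw + (1 - δ) * A_pru + δ * A_apruw + (1 - δ) * (1 - ε) * A_pqru + (δ * ε + δ * (1 - ε) + (1 - δ) * ε) * A_apqruw := by
    rw [sum_eq_sum_goodWt2 U ν p r u hbad]
    simp only [hA_e, hA_p, hA_q, hA_pq, hA_pr, hA_aqw, hA_pqr, hA_pru, hA_apqw, hA_pqru, hA_apqrw, hA_apruw, hA_apqruw, cellSum4, Finset.mul_sum, ← Finset.sum_add_distrib]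
    exact Finset.sum_congr rfl hpg
  have hX : ∑ W ∈ U.powerset, ν W * gVal A u q a w δ ε W * (if p ∈ W then (1 : R) else 0) =
      A_p + (1 - ε) * A_pq + ε * A_apqw + A_pr + (1 - ε) * A_pqr + ε * A_apqrw + (1 - δ) * A_pru + δ * A_apruw + (1 - δ) * (1 - ε) * A_pqru + (δ * ε + δ * (1 - ε) + (1 - δ) * ε) * A_apqruw := by
    rw [sum_eq_sum_goodWt2' U ν p r u hbad]
    simp only [hA_p, hA_pq, hA_pr, hA_pqr, hA_pru, hA_apqw, hA_pqru, hA_apqrw, hA_apruw, hA_apqruw, cellSum4, Finset.mul_sum, ← Finset.sum_add_distrib]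
    refine Finset.sum_congr rfl fun W hW => ?_
    rw [hpg W hW]
    simp only [cellWt4, mWt, Finset.union_empty]
    by_cases hp : p ∈ W <;> by_cases hr : r ∈ W <;> by_cases hu : u ∈ W <;> by_cases hq : q ∈ W <;> simp [hp, hr, hu, hq]
  have hY : ∑ W ∈ U.powerset, ν W * gVal A u q a w δ ε W * (if r ∈ W then (1 : R) else 0) =
      A_pr + (1 - ε) * A_pqr + ε * A_apqrw + (1 - δ) * A_pru + δ * A_apruw + (1 - δ) * (1 - ε) * A_pqru + (δ * ε + δ * (1 - ε) + (1 - δ) * ε) * A_apqruw := by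
    rw [sum_eq_sum_goodWt2' U ν p r u hbad]
    simp only [hA_pr, hA_pqr, hA_pru, hA_pqru, hA_apqrw, hA_apruw, hA_apqruw, cellSum4, Finset.mul_sum, ← Finset.sum_add_distrib]
    refine Finset.sum_congr rfl fun W hW => ?_
    rw [hpg W hW]
    simp only [cellWt4, mWt, Finset.union_empty]
    by_cases hp : p ∈ W <;> by_cases hr : r ∈ W <;> by_cases hu : u ∈ W <;> by_cases hq : q ∈ W <;> simp [hp, hr, hu, hq]
  have hXY : ∑ W ∈ U.powerset, ν W * gVal A u q a w δ ε W * ((if p ∈ W then (1 : R) else 0) * (if r ∈ W then (1 : R) else 0)) =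
      A_pr + (1 - ε) * A_pqr + ε * A_apqrw + (1 - δ) * A_pru + δ * A_apruw + (1 - δ) * (1 - ε) * A_pqru + (δ * ε + δ * (1 - ε) + (1 - δ) * ε) * A_apqruw := by
    rw [sum_eq_sum_goodWt2' U ν p r u hbad]
    simp only [hA_pr, hA_pqr, hA_pru, hA_pqru, hA_apqrw, hA_apruw, hA_apqruw, cellSum4, Finset.mul_sum, ← Finset.sum_add_distrib]
    refine Finset.sum_congr rfl fun W hW => ?_
    rw [hpg W hW]
    simp only [cellWt4, mWt, Finset.union_empty]
    by_cases hp : p ∈ W <;> by_cases hr : r ∈ W <;> by_cases hu : u ∈ W <;> by_cases hq : q ∈ W <;> simp [hp, hr, hu, hq]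
  rw [hΛ, hFa, hFb, hM, hX, hY, hXY]
  linear_combination key

end OrTailFar2Alg

end Summit.Ventures.PercRepro2.Coin
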